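import Summits.NavierStokesRegularity.NavierStokesRegularity.Theorems.LevelSetModerationModerationIdentity

/-!
# Route LevelSetModeration — `HighSpeedPressureWork`: the moderated Cauchy–Schwarz step on a slice

Support file for item stmt-NavierStokesRegularity-18149 (transfer of the birth line
`ModeratedCauchySchwarz → HeadDecorrelation → HighSpeedPressureWork`). For ONE time slice: a `C¹`
divergence-free field `v` on `ℝ³` with bounded super-level set `A = {c < |v|}` (`c > 0`), a `C¹`
pressure `q` and a continuous moderator `φ`. GIVEN the level-set integration by parts
`-∫ (1-c/|v|)₊ Dq(v) = ∫ 1_A (c/|v|²)(D|v|(v)) q` (registered stub `stub_levelSetIBP` of the crux,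
taken here as a hypothesis on the slice), the landed `ModerationIdentity` removes `φ(|v|)` from `q`
and Cauchy–Schwarz on `A` gives

  `-∫ (1-c/|v|)₊ Dq(v) ≤ √(∫ 1_A (q - φ(|v|))²) · √(∫ 1_A |D|v||²)`

(`|c/|v|² · D|v|(v)| ≤ (c/|v|) |D|v|| ≤ |D|v||` on `A`). Also the conversion of both factors to the
`toReal` of lower Lebesgue integrals (the currency of the crux).
-/

noncomputable section

-- single-conjunct summit: `Summit.<Summit>.<Problem>` repeats the name by the D-0017 layout
set_option linter.dupNamespace false

namespace Summit.NavierStokesRegularity.NavierStokesRegularity.Theorems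

open MeasureTheory Set Filter Topology
open scoped ENNReal RealInnerProductSpace
open Literature.Analysis.FluidPDE

section Slice

variable {v : EuclideanSpace ℝ (Fin 3) → EuclideanSpace ℝ (Fin 3)} {c : ℝ}

/-- On the closure of a bounded super-level set `{c < |v|}` (`c > 0`, `v ∈ C¹`) the field does not
vanish, the closure is compact and contained in `{c ≤ |v|}`. [folklore] -/
theorem levelSetModeration_closure_superlevel (hc : 0 < c) (hv : ContDiff ℝ 1 v)
    (hbdd : Bornology.IsBounded {x | c < ‖v x‖}) :
    IsCompact (closure {x | c < ‖v x‖}) ∧ closure {x | c < ‖v x‖} ⊆ {x | c ≤ ‖v x‖} ∧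
      ∀ x ∈ closure {x | c < ‖v x‖}, v x ≠ 0 := by
  have hsub : closure {x | c < ‖v x‖} ⊆ {x | c ≤ ‖v x‖} :=
    closure_minimal (fun x (hx : c < ‖v x‖) => show c ≤ ‖v x‖ from le_of_lt hx)
      (isClosed_le continuous_const hv.continuous.norm)
  refine ⟨hbdd.isCompact_closure, hsub, fun x hx h0 => ?_⟩
  have hcx : c ≤ ‖v x‖ := hsub hx
  rw [h0, norm_zero] at hcx
  exact absurd hcx (not_le.2 hc)

/-- **Integrability on a bounded super-level set.** For `v ∈ C¹` with `{c < |v|}` bounded (`c > 0`)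
and `g` continuous at every point where `v ≠ 0`, the function `1_{c<|v|} g` is integrable.
[folklore] -/
theorem levelSetModeration_integrable_indicator_superlevel (hc : 0 < c) (hv : ContDiff ℝ 1 v)
    (hbdd : Bornology.IsBounded {x | c < ‖v x‖}) {g : EuclideanSpace ℝ (Fin 3) → ℝ}
    (hg : ∀ x, v x ≠ 0 → ContinuousAt g x) :
    Integrable ({x | c < ‖v x‖}.indicator g) volume := by
  obtain ⟨hK, -, hne⟩ := levelSetModeration_closure_superlevel hc hv hbdd
  have hA_open : IsOpen {x | c < ‖v x‖} := isOpen_lt continuous_const hv.continuous.norm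
  refine IntegrableOn.integrable_indicator ?_ hA_open.measurableSet
  exact (ContinuousOn.integrableOn_compact hK fun x hx =>
    (hg x (hne x hx)).continuousWithinAt).mono_set subset_closure

/-- The speed gradient `x ↦ D|v|(x)` is continuous at every point where `v ≠ 0` (`v ∈ C¹`).
[folklore] -/
theorem levelSetModeration_continuousAt_fderiv_norm (hv : ContDiff ℝ 1 v)
    {x : EuclideanSpace ℝ (Fin 3)} (hx : v x ≠ 0) :
    ContinuousAt (fderiv ℝ fun y => ‖v y‖) x :=
  ((hv.contDiffAt.norm ℝ hx).fderiv_right (m := 0) le_rfl).continuousAt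

/-- **Pointwise bound for the level-set pairing density** on `{c < |v|}`:
`|c/|v|² · D|v|(x)(v x)| ≤ ‖D|v|(x)‖`. [folklore] -/
theorem levelSetModeration_abs_pairingDensity_le (hc : 0 < c) {x : EuclideanSpace ℝ (Fin 3)}
    (hx : c < ‖v x‖) :
    |c / ‖v x‖ ^ 2 * fderiv ℝ (fun y => ‖v y‖) x (v x)| ≤ ‖fderiv ℝ (fun y => ‖v y‖) x‖ := by
  have hv0 : 0 < ‖v x‖ := hc.trans hx
  rw [abs_mul, abs_of_nonneg (by positivity : 0 ≤ c / ‖v x‖ ^ 2)]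
  have h1 : |fderiv ℝ (fun y => ‖v y‖) x (v x)| ≤ ‖fderiv ℝ (fun y => ‖v y‖) x‖ * ‖v x‖ := by
    rw [← Real.norm_eq_abs]
    exact ContinuousLinearMap.le_opNorm _ _
  calc c / ‖v x‖ ^ 2 * |fderiv ℝ (fun y => ‖v y‖) x (v x)|
      ≤ c / ‖v x‖ ^ 2 * (‖fderiv ℝ (fun y => ‖v y‖) x‖ * ‖v x‖) := by gcongr
    _ = (c / ‖v x‖) * ‖fderiv ℝ (fun y => ‖v y‖) x‖ := by
        field_simp
    _ ≤ 1 * ‖fderiv ℝ (fun y => ‖v y‖) x‖ := by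
        gcongr
        rw [div_le_one hv0]
        exact hx.le
    _ = ‖fderiv ℝ (fun y => ‖v y‖) x‖ := one_mul _

/-- **Moderated Cauchy–Schwarz on a slice.** Let `v ∈ C¹(ℝ³; ℝ³)` be divergence free with bounded
super-level set `A = {c < |v|}` (`c > 0`), `q ∈ C¹(ℝ³)` and `φ : ℝ → ℝ` continuous. If the level-set
integration by parts `-∫ (1-c/|v|)₊ Dq(v) = ∫ 1_A (c/|v|²)(D|v|(v)) q` holds for this slice, then

  `-∫ (1-c/|v|)₊ Dq(x)(v x) dx ≤ √(∫ 1_A (q - φ(|v|))²) · √(∫ 1_A ‖D|v|‖²)`: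

the moderator is removed by `ModerationIdentity` (`∫ 1_A φ(|v|)(c/|v|²) D|v|(v) = 0`, landed item
stmt-NavierStokesRegularity-18152), the density is bounded by `|q - φ(|v|)| ‖D|v|‖` on `A`
(`levelSetModeration_abs_pairingDensity_le`), and Hölder with exponents `2, 2` concludes (Tran–Yu
pressure moderation in the De Giorgi pairing; the birth line's `ModeratedCauchySchwarz`, slice form).
[folklore] -/
theorem levelSetModeration_moderatedCauchySchwarz_slice (hc : 0 < c) (hv : ContDiff ℝ 1 v)
    (hdiv : VectorCalculus.IsDivFree v) (hbdd : Bornology.IsBounded {x | c < ‖v x‖})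
    {q : EuclideanSpace ℝ (Fin 3) → ℝ} (hq : Continuous q) {φ : ℝ → ℝ} (hφ : Continuous φ)
    (hIBP : -(∫ x, max (1 - c / ‖v x‖) 0 * (fderiv ℝ q x (v x))) =
      ∫ x, {x | c < ‖v x‖}.indicator
        (fun x => c / ‖v x‖ ^ 2 * (fderiv ℝ (fun y => ‖v y‖) x (v x)) * q x) x) :
    -(∫ x, max (1 - c / ‖v x‖) 0 * (fderiv ℝ q x (v x))) ≤
      Real.sqrt (∫ x, {x | c < ‖v x‖}.indicator (fun x => (q x - φ ‖v x‖) ^ 2) x) *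
        Real.sqrt (∫ x, {x | c < ‖v x‖}.indicator
          (fun x => ‖fderiv ℝ (fun y => ‖v y‖) x‖ ^ 2) x) := by
  set A : Set (EuclideanSpace ℝ (Fin 3)) := {x | c < ‖v x‖} with hA
  set k : EuclideanSpace ℝ (Fin 3) → ℝ :=
    fun x => c / ‖v x‖ ^ 2 * fderiv ℝ (fun y => ‖v y‖) x (v x) with hk
  have hvc : Continuous v := hv.continuous
  -- continuity at the points of `{v ≠ 0}` of the building blocks
  have hk_cont : ∀ x, v x ≠ 0 → ContinuousAt k x := by
    intro x hx
    have h2 : ContinuousAt (fun y => c / ‖v y‖ ^ 2) x :=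
      continuousAt_const.div (hvc.norm.pow 2).continuousAt (pow_ne_zero 2 (norm_ne_zero_iff.2 hx))
    exact h2.mul ((levelSetModeration_continuousAt_fderiv_norm hv hx).clm_apply hvc.continuousAt)
  have hφv : Continuous fun x => φ ‖v x‖ := hφ.comp hvc.norm
  -- Step 1: remove the moderator
  have hmod0 : ∫ x, A.indicator (fun x => k x * φ ‖v x‖) x = 0 := by
    have h := levelSetModeration_moderationIdentity_proof v φ c hc hv hdiv hφ hbdd
    rw [← h]
    refine integral_congr_ae (Eventually.of_forall fun x => ?_)
    by_cases hx : x ∈ A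
    · rw [indicator_of_mem hx, indicator_of_mem hx, hk]
      ring
    · rw [indicator_of_notMem hx, indicator_of_notMem hx]
  have hI1 : Integrable (A.indicator fun x => k x * q x) volume :=
    levelSetModeration_integrable_indicator_superlevel hc hv hbdd fun x hx =>
      (hk_cont x hx).mul hq.continuousAt
  have hI2 : Integrable (A.indicator fun x => k x * φ ‖v x‖) volume :=
    levelSetModeration_integrable_indicator_superlevel hc hv hbdd fun x hx =>
      (hk_cont x hx).mul hφv.continuousAt
  have hsplit : -(∫ x, max (1 - c / ‖v x‖) 0 * (fderiv ℝ q x (v x))) =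
      ∫ x, A.indicator (fun x => k x * (q x - φ ‖v x‖)) x := by
    rw [hIBP]
    have : (A.indicator fun x => k x * (q x - φ ‖v x‖)) =
        fun x => A.indicator (fun x => k x * q x) x - A.indicator (fun x => k x * φ ‖v x‖) x := by
      funext x
      by_cases hx : x ∈ A
      · simp only [indicator_of_mem hx]
        ring
      · simp only [indicator_of_notMem hx, sub_zero]
    rw [this, integral_sub hI1 hI2, hmod0, sub_zero]
  -- Step 2: pointwise domination by `|q - φ(|v|)| ‖D|v|‖` on `A`
  set f : EuclideanSpace ℝ (Fin 3) → ℝ := A.indicator fun x => |q x - φ ‖v x‖| with hf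
  set g : EuclideanSpace ℝ (Fin 3) → ℝ :=
    A.indicator fun x => ‖fderiv ℝ (fun y => ‖v y‖) x‖ with hg
  have hdom : ∀ x, A.indicator (fun x => k x * (q x - φ ‖v x‖)) x ≤ f x * g x := by
    intro x
    by_cases hx : x ∈ A
    · rw [indicator_of_mem hx, hf, hg, indicator_of_mem hx, indicator_of_mem hx]
      have hx' : c < ‖v x‖ := hx
      calc k x * (q x - φ ‖v x‖) ≤ |k x * (q x - φ ‖v x‖)| := le_abs_self _
        _ = |k x| * |q x - φ ‖v x‖| := abs_mul _ _
        _ ≤ ‖fderiv ℝ (fun y => ‖v y‖) x‖ * |q x - φ ‖v x‖| := by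
            gcongr
            exact levelSetModeration_abs_pairingDensity_le hc hx'
        _ = |q x - φ ‖v x‖| * ‖fderiv ℝ (fun y => ‖v y‖) x‖ := mul_comm _ _
    · simp [indicator_of_notMem hx, hf, hg]
  -- integrability / square-integrability of `f`, `g`
  have hf_int2 : Integrable (fun x => f x ^ 2) volume := by
    have : (fun x => f x ^ 2) = A.indicator fun x => (q x - φ ‖v x‖) ^ 2 := by
      funext x
      by_cases hx : x ∈ A
      · simp [hf, indicator_of_mem hx, sq_abs]
      · simp [hf, indicator_of_notMem hx]
    rw [this]
    exact levelSetModeration_integrable_indicator_superlevel hc hv hbdd fun x _ =>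
      ((hq.sub hφv).pow 2).continuousAt
  have hg_int2 : Integrable (fun x => g x ^ 2) volume := by
    have : (fun x => g x ^ 2) = A.indicator fun x => ‖fderiv ℝ (fun y => ‖v y‖) x‖ ^ 2 := by
      funext x
      by_cases hx : x ∈ A
      · simp [hg, indicator_of_mem hx]
      · simp [hg, indicator_of_notMem hx]
    rw [this]
    exact levelSetModeration_integrable_indicator_superlevel hc hv hbdd fun x hx =>
      ((levelSetModeration_continuousAt_fderiv_norm hv hx).norm.pow 2)
  have hA_meas : MeasurableSet A := (isOpen_lt continuous_const hvc.norm).measurableSet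
  have hf_meas : AEStronglyMeasurable f volume :=
    ((hq.sub hφv).abs.aestronglyMeasurable).indicator hA_meas
  have hg_meas : AEStronglyMeasurable g volume := by
    refine (aestronglyMeasurable_indicator_iff hA_meas).2 ?_
    obtain ⟨hK, -, hne⟩ := levelSetModeration_closure_superlevel hc hv hbdd
    have hcont : ContinuousOn (fun x => ‖fderiv ℝ (fun y => ‖v y‖) x‖) A := fun x hx =>
      ((levelSetModeration_continuousAt_fderiv_norm hv (hne x (subset_closure hx))).norm)
        |>.continuousWithinAt
    exact hcont.aestronglyMeasurable hA_meas
  have hfL2 : MemLp f (ENNReal.ofReal 2) volume := by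
    rw [ENNReal.ofReal_ofNat, memLp_two_iff_integrable_sq hf_meas]
    exact hf_int2
  have hgL2 : MemLp g (ENNReal.ofReal 2) volume := by
    rw [ENNReal.ofReal_ofNat, memLp_two_iff_integrable_sq hg_meas]
    exact hg_int2
  have hf0 : ∀ x, 0 ≤ f x := fun x => by
    by_cases hx : x ∈ A
    · simp [hf, indicator_of_mem hx, abs_nonneg]
    · simp [hf, indicator_of_notMem hx]
  have hg0 : ∀ x, 0 ≤ g x := fun x => by
    by_cases hx : x ∈ A
    · simp [hg, indicator_of_mem hx, norm_nonneg]
    · simp [hg, indicator_of_notMem hx]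
  -- the product `f g` is integrable (`f g ≤ (f² + g²)/2`)
  have hfg_int : Integrable (fun x => f x * g x) volume := by
    refine ((hf_int2.add hg_int2).div_const 2).mono' (hf_meas.mul hg_meas)
      (Eventually.of_forall fun x => ?_)
    rw [Real.norm_of_nonneg (mul_nonneg (hf0 x) (hg0 x))]
    change f x * g x ≤ (f x ^ 2 + g x ^ 2) / 2
    nlinarith [sq_nonneg (f x - g x), hf0 x, hg0 x]
  have hL_int : Integrable (A.indicator fun x => k x * (q x - φ ‖v x‖)) volume :=
    levelSetModeration_integrable_indicator_superlevel hc hv hbdd fun x hx =>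
      (hk_cont x hx).mul (hq.sub hφv).continuousAt
  -- Step 3: Hölder `2, 2`
  have hH := integral_mul_le_Lp_mul_Lq_of_nonneg (μ := volume) Real.HolderConjugate.two_two
    (Eventually.of_forall hf0) (Eventually.of_forall hg0) hfL2 hgL2
  have hIf : (∫ x, f x ^ (2 : ℝ)) = ∫ x, A.indicator (fun x => (q x - φ ‖v x‖) ^ 2) x := by
    refine integral_congr_ae (Eventually.of_forall fun x => ?_)
    change f x ^ (2 : ℝ) = A.indicator (fun x => (q x - φ ‖v x‖) ^ 2) x
    rw [Real.rpow_two]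
    by_cases hx : x ∈ A
    · simp [hf, indicator_of_mem hx, sq_abs]
    · simp [hf, indicator_of_notMem hx]
  have hIg : (∫ x, g x ^ (2 : ℝ)) =
      ∫ x, A.indicator (fun x => ‖fderiv ℝ (fun y => ‖v y‖) x‖ ^ 2) x := by
    refine integral_congr_ae (Eventually.of_forall fun x => ?_)
    change g x ^ (2 : ℝ) = A.indicator (fun x => ‖fderiv ℝ (fun y => ‖v y‖) x‖ ^ 2) x
    rw [Real.rpow_two]
    by_cases hx : x ∈ A
    · simp [hg, indicator_of_mem hx]
    · simp [hg, indicator_of_notMem hx]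
  rw [hIf, hIg] at hH
  calc -(∫ x, max (1 - c / ‖v x‖) 0 * (fderiv ℝ q x (v x)))
      = ∫ x, A.indicator (fun x => k x * (q x - φ ‖v x‖)) x := hsplit
    _ ≤ ∫ x, f x * g x := integral_mono hL_int hfg_int hdom
    _ ≤ (∫ x, A.indicator (fun x => (q x - φ ‖v x‖) ^ 2) x) ^ (1 / (2 : ℝ)) *
          (∫ x, A.indicator (fun x => ‖fderiv ℝ (fun y => ‖v y‖) x‖ ^ 2) x) ^ (1 / (2 : ℝ)) := hH
    _ = _ := by rw [← Real.sqrt_eq_rpow, ← Real.sqrt_eq_rpow]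

/-- A real integral of a nonnegative integrable `1_s h` is the `toReal` of the corresponding lower
Lebesgue integral of `1_s (ofReal ∘ h)`. [folklore] -/
theorem levelSetModeration_integral_indicator_eq_toReal_lintegral
    {s : Set (EuclideanSpace ℝ (Fin 3))} {h : EuclideanSpace ℝ (Fin 3) → ℝ}
    (h0 : ∀ x, 0 ≤ h x) (hint : Integrable (s.indicator h) volume) :
    ∫ x, s.indicator h x = (∫⁻ x, s.indicator (fun x => ENNReal.ofReal (h x)) x).toReal := by
  rw [integral_eq_lintegral_of_nonneg_ae (Eventually.of_forall fun x =>
    indicator_nonneg (fun y _ => h0 y) x) hint.aestronglyMeasurable]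
  congr 1
  refine lintegral_congr fun x => ?_
  by_cases hx : x ∈ s
  · rw [indicator_of_mem hx, indicator_of_mem hx]
  · rw [indicator_of_notMem hx, indicator_of_notMem hx, ENNReal.ofReal_zero]

/-- **Moderated Cauchy–Schwarz on a slice, in the currency of the crux** (`toReal` of lower Lebesgue
integrals under the square roots): under the hypotheses of
`levelSetModeration_moderatedCauchySchwarz_slice`,
`-∫ (1-c/|v|)₊ Dq(v) ≤ √((∫⁻ 1_A ofReal((q-φ(|v|))²)).toReal) · √((∫⁻ 1_A ofReal(‖D|v|‖²)).toReal)`.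
[folklore] -/
theorem levelSetModeration_moderatedCauchySchwarz_slice_lintegral (hc : 0 < c) (hv : ContDiff ℝ 1 v)
    (hdiv : VectorCalculus.IsDivFree v) (hbdd : Bornology.IsBounded {x | c < ‖v x‖})
    {q : EuclideanSpace ℝ (Fin 3) → ℝ} (hq : Continuous q) {φ : ℝ → ℝ} (hφ : Continuous φ)
    (hIBP : -(∫ x, max (1 - c / ‖v x‖) 0 * (fderiv ℝ q x (v x))) =
      ∫ x, {x | c < ‖v x‖}.indicator
        (fun x => c / ‖v x‖ ^ 2 * (fderiv ℝ (fun y => ‖v y‖) x (v x)) * q x) x) :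
    -(∫ x, max (1 - c / ‖v x‖) 0 * (fderiv ℝ q x (v x))) ≤
      Real.sqrt (∫⁻ x, {x | c < ‖v x‖}.indicator
          (fun x => ENNReal.ofReal ((q x - φ ‖v x‖) ^ 2)) x).toReal *
        Real.sqrt (∫⁻ x, {x | c < ‖v x‖}.indicator
          (fun x => ENNReal.ofReal (‖fderiv ℝ (fun y => ‖v y‖) x‖ ^ 2)) x).toReal := by
  have hφv : Continuous fun x => φ ‖v x‖ := hφ.comp hv.continuous.norm
  have h1 : Integrable ({x | c < ‖v x‖}.indicator fun x => (q x - φ ‖v x‖) ^ 2) volume :=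
    levelSetModeration_integrable_indicator_superlevel hc hv hbdd fun x _ =>
      ((hq.sub hφv).pow 2).continuousAt
  have h2 : Integrable ({x | c < ‖v x‖}.indicator
      fun x => ‖fderiv ℝ (fun y => ‖v y‖) x‖ ^ 2) volume :=
    levelSetModeration_integrable_indicator_superlevel hc hv hbdd fun x hx =>
      ((levelSetModeration_continuousAt_fderiv_norm hv hx).norm.pow 2)
  rw [← levelSetModeration_integral_indicator_eq_toReal_lintegral (fun x => sq_nonneg _) h1,
    ← levelSetModeration_integral_indicator_eq_toReal_lintegral (fun x => sq_nonneg _) h2]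
  exact levelSetModeration_moderatedCauchySchwarz_slice hc hv hdiv hbdd hq hφ hIBP

end Slice

/-- **Moderated Cauchy–Schwarz on a slice** (explicit form of
`levelSetModeration_moderatedCauchySchwarz_slice_lintegral`, registered sub-goal of the crux
item): for `v ∈ C¹` divergence free with `{c < |v|}` bounded (`c > 0`), continuous `q`, `φ`, and the
level-set integration by parts for this slice,
`-∫ (1-c/|v|)₊ Dq(v) ≤ √((∫⁻ 1_A ofReal((q-φ(|v|))²)).toReal) · √((∫⁻ 1_A ofReal(‖D|v|‖²)).toReal)`.
[folklore] -/
theorem levelSetModeration_moderatedCauchySchwarzSlice :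
    ∀ (v : EuclideanSpace ℝ (Fin 3) → EuclideanSpace ℝ (Fin 3)) (q : EuclideanSpace ℝ (Fin 3) → ℝ) (φ : ℝ → ℝ) (c : ℝ), 0 < c → ContDiff ℝ 1 v → Literature.Analysis.FluidPDE.VectorCalculus.IsDivFree v → Bornology.IsBounded {x | c < ‖v x‖} → Continuous q → Continuous φ → -(∫ x, max (1 - c / ‖v x‖) 0 * (fderiv ℝ q x (v x))) = ∫ x, Set.indicator {x | c < ‖v x‖} (fun x => c / ‖v x‖ ^ 2 * (fderiv ℝ (fun y => ‖v y‖) x (v x)) * q x) x → -(∫ x, max (1 - c / ‖v x‖) 0 * (fderiv ℝ q x (v x))) ≤ Real.sqrt (∫⁻ x, Set.indicator {x | c < ‖v x‖} (fun x => ENNReal.ofReal ((q x - φ ‖v x‖) ^ 2)) x).toReal * Real.sqrt (∫⁻ x, Set.indicator {x | c < ‖v x‖} (fun x => ENNReal.ofReal (‖fderiv ℝ (fun y => ‖v y‖) x‖ ^ 2)) x).toReal :=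
  fun _ _ _ _ hc hv hdiv hbdd hq hφ hIBP =>
    levelSetModeration_moderatedCauchySchwarz_slice_lintegral hc hv hdiv hbdd hq hφ hIBP

end Summit.NavierStokesRegularity.NavierStokesRegularity.Theorems
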